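import Mathlib
import Literature.Computability.AlgebraicComplexity.SymmetricArithCircuit
import HarnessLib

/-!
# The orbit circuit of a diagonally invariant matrix polynomial (a symmetric depth-two circuit)

Topic `Computability/AlgebraicComplexity`, namespace
`Literature.Computability.AlgebraicComplexity.OrbitCircuit`.

Companion of `SymmetricArithCircuit.lean` (Dawar–Wilsenach symmetric arithmetic circuits,
`LabelledArithCircuit` = Def. 2.2, `SymmetricArithmeticCircuit` = Def. 3.7 bundled) and of
`SymmetricArithCircuitNaive.lean`.  For a polynomial `p` on the `n × n` variable matrix
`x_pq` that is invariant under the DIAGONAL action `x_pq ↦ x_{σ p, σ q}` of `Sym(Fin n)`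
("square-symmetric" polynomials, Dawar–Wilsenach §3.2), the textbook depth-two circuit

* inputs `inp pq` (label `x_pq`), for every monomial `m ∈ supp p` and every `pq`, `t < D` a COPY
  gate `cpy m pq t` (a `+` gate with the single child `inp pq`; product gates of a
  `LabelledArithCircuit` take a SET of children, so the power `x_pq ^ (m pq)` needs `m pq`
  distinct children), one product gate `mono m` with children `{cst (coeff m)} ∪ copies`, one
  constant gate `cst c` per coefficient VALUE (input labels must be injective), and the output
  `out = Σ_m mono m`,

is a `SymmetricArithmeticCircuit (Equiv.Perm (Fin n))` (`orbitCircuit`): `σ` acts by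
`inp pq ↦ inp (σ pq)`, `mono m ↦ mono (σ m)`, …, which is well defined because the support of an
invariant polynomial is an invariant set of monomials on which the coefficient is constant
(`coeff_smulMon`, `smulMon_mem_support`).  Gate count
`≤ n² + |supp p| · n² · D + 2 |supp p| + 1` (`Gate.card_le`).  The evaluation (`out` computes `p`
when `D ≥ deg p`) and the resulting existence statement are in `SymmetricOrbitCircuitEval.lean`.
Everything is proved; folklore (it is the trivial upper bound `|supp p| · deg p + O(n²)` for the
square-symmetric circuit SIZE of an invariant polynomial, used by route
`Summits/ValiantsHypothesis/…/Theses/MonotoneRestoration.lean` to dispose of the sparse /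
polylog-degree regime of its crux `MonotoneRestorationQP`).

What is NOT here: matrix-symmetric (`Sym_n × Sym_m`) or other group actions (the same
construction works verbatim; only the diagonal action is needed downstream); minimality of the
circuit; rigidity.
-/

noncomputable section

open scoped Classical

namespace Literature.Computability.AlgebraicComplexity

open MvPolynomial

namespace OrbitCircuit

universe u

variable {n : ℕ}

/-! ### The diagonal action on monomials -/

/-- The diagonal action of `σ ∈ Sym(Fin n)` on an exponent vector (monomial) of the `n × n`
variable matrix: `x_pq ↦ x_{σ p, σ q}`. [folklore] -/
def smulMon (σ : Equiv.Perm (Fin n)) (m : (Fin n × Fin n) →₀ ℕ) : (Fin n × Fin n) →₀ ℕ :=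
  Finsupp.mapDomain (fun pq => σ • pq) m

/-- The diagonal action on matrix positions is `(p, q) ↦ (σ p, σ q)`. [folklore] -/
theorem smul_pair (σ : Equiv.Perm (Fin n)) (pq : Fin n × Fin n) : σ • pq = (σ pq.1, σ pq.2) := rfl

/-- `smulMon 1 = id`. [folklore] -/
@[simp] theorem smulMon_one (m : (Fin n × Fin n) →₀ ℕ) : smulMon 1 m = m := by
  have : (fun pq : Fin n × Fin n => (1 : Equiv.Perm (Fin n)) • pq) = id :=
    funext fun _ => one_smul _ _
  rw [smulMon, this, Finsupp.mapDomain_id]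

/-- `smulMon` is multiplicative. [folklore] -/
theorem smulMon_mul (σ τ : Equiv.Perm (Fin n)) (m : (Fin n × Fin n) →₀ ℕ) :
    smulMon (σ * τ) m = smulMon σ (smulMon τ m) := by
  simp only [smulMon, ← Finsupp.mapDomain_comp]
  rfl

/-- The action on monomials evaluates as `(σ • m) (σ • pq) = m pq`. [folklore] -/
@[simp] theorem smulMon_apply_smul (σ : Equiv.Perm (Fin n)) (m : (Fin n × Fin n) →₀ ℕ)
    (pq : Fin n × Fin n) : smulMon σ m (σ • pq) = m pq :=
  Finsupp.mapDomain_apply (MulAction.injective σ) m pq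

/-- The support of `σ • m` is the image of the support. [folklore] -/
theorem support_smulMon (σ : Equiv.Perm (Fin n)) (m : (Fin n × Fin n) →₀ ℕ) :
    (smulMon σ m).support = m.support.image (fun pq => σ • pq) :=
  Finsupp.mapDomain_support_of_injective (MulAction.injective σ) m

/-- Renaming by the diagonal action sends the monomial `m` to the monomial `σ • m`. [folklore] -/
theorem rename_monomial_smul {K : Type u} [CommSemiring K] (σ : Equiv.Perm (Fin n))
    (m : (Fin n × Fin n) →₀ ℕ) (c : K) :
    rename (fun pq : Fin n × Fin n => σ • pq) (monomial m c) = monomial (smulMon σ m) c :=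
  rename_monomial _ _ _

/-- Coefficients of a diagonally invariant polynomial are constant on orbits of monomials.
[folklore] -/
theorem coeff_smulMon {K : Type u} [CommSemiring K] {p : MvPolynomial (Fin n × Fin n) K}
    (hp : ∀ σ : Equiv.Perm (Fin n), rename (fun pq : Fin n × Fin n => σ • pq) p = p)
    (σ : Equiv.Perm (Fin n)) (m : (Fin n × Fin n) →₀ ℕ) : p.coeff (smulMon σ m) = p.coeff m := by
  conv_lhs => rw [← hp σ]
  exact coeff_rename_mapDomain _ (MulAction.injective σ) p m

/-- The support of a diagonally invariant polynomial is invariant. [folklore] -/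
theorem smulMon_mem_support {K : Type u} [CommSemiring K] {p : MvPolynomial (Fin n × Fin n) K}
    (hp : ∀ σ : Equiv.Perm (Fin n), rename (fun pq : Fin n × Fin n => σ • pq) p = p)
    (σ : Equiv.Perm (Fin n)) {m : (Fin n × Fin n) →₀ ℕ} (hm : m ∈ p.support) :
    smulMon σ m ∈ p.support := by
  rw [mem_support_iff] at hm ⊢
  rwa [coeff_smulMon hp]

/-! ### The gates of the orbit circuit -/

section Circuit

variable {K : Type u} [CommSemiring K] (p : MvPolynomial (Fin n × Fin n) K)

/-- The finite set of coefficient values of `p`. [folklore] -/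
def coeffs : Finset K := p.support.image fun m => p.coeff m

/-- The coefficient of a monomial of the support, as an element of `coeffs p`. [folklore] -/
def coeffOf (m : p.support) : coeffs p := ⟨p.coeff m.1, Finset.mem_image_of_mem _ m.2⟩

/-- Gates of the orbit circuit of `p` (with `D` copies of each input available to every
product gate): inputs `inp pq`, copies `cpy m pq t` (a `+` gate with the single child
`inp pq`), monomial gates `mono m` (`×`), constant gates `cst c`, and the output `out` (`+`).
[folklore] -/
inductive Gate (D : ℕ) : Type u
  /-- Input gate `x_pq`. -/
  | inp (pq : Fin n × Fin n) : Gate D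
  /-- The `t`-th copy of `x_pq` reserved for the monomial gate `m`. -/
  | cpy (m : p.support) (pq : Fin n × Fin n) (t : Fin D) : Gate D
  /-- The product gate computing `coeff m · x^m`. -/
  | mono (m : p.support) : Gate D
  /-- The constant gate `c`. -/
  | cst (c : coeffs p) : Gate D
  /-- The output gate `Σ_m coeff m · x^m`. -/
  | out : Gate D

variable {p} {D : ℕ}

namespace Gate

/-- The gates embed in a sum of finite types. [folklore] -/
def toSum : Gate p D → (Fin n × Fin n) ⊕ (p.support × (Fin n × Fin n) × Fin D) ⊕ p.support ⊕
    coeffs p ⊕ Unit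
  | inp pq => Sum.inl pq
  | cpy m pq t => Sum.inr (Sum.inl (m, pq, t))
  | mono m => Sum.inr (Sum.inr (Sum.inl m))
  | cst c => Sum.inr (Sum.inr (Sum.inr (Sum.inl c)))
  | out => Sum.inr (Sum.inr (Sum.inr (Sum.inr ())))

/-- `toSum` is injective. [folklore] -/
theorem toSum_injective : Function.Injective (toSum (p := p) (D := D)) := by
  intro g g' h
  cases g <;> cases g' <;> simp_all [toSum]

/-- The gate type is finite. [folklore] -/
instance instFintype : Fintype (Gate p D) := Fintype.ofInjective _ toSum_injective

/-- Gate count: at most `n² + |supp p| · n² · D + |supp p| + |supp p| + 1`. [folklore] -/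
theorem card_le : Fintype.card (Gate p D) ≤
    n * n + p.support.card * (n * n * D) + p.support.card + p.support.card + 1 := by
  have h := Fintype.card_le_of_injective _ (toSum_injective (p := p) (D := D))
  simp only [Fintype.card_sum, Fintype.card_prod, Fintype.card_fin, Fintype.card_coe,
    Fintype.card_unit] at h
  have hc : (coeffs p).card ≤ p.support.card := Finset.card_image_le
  omega

variable [hp : Fact (∀ σ : Equiv.Perm (Fin n), rename (fun pq : Fin n × Fin n => σ • pq) p = p)]

/-- The diagonal action on the monomials of the support. [folklore] -/
def smulSupp (σ : Equiv.Perm (Fin n)) (m : p.support) : p.support :=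
  ⟨smulMon σ m.1, smulMon_mem_support hp.out σ m.2⟩

/-- Underlying monomial of the action on the support. [folklore] -/
@[simp] theorem smulSupp_val (σ : Equiv.Perm (Fin n)) (m : p.support) :
    (smulSupp σ m).1 = smulMon σ m.1 := rfl

/-- The identity acts trivially on the support. [folklore] -/
theorem smulSupp_one (m : p.support) : smulSupp (1 : Equiv.Perm (Fin n)) m = m :=
  Subtype.ext (smulMon_one m.1)

/-- The action on the support is multiplicative. [folklore] -/
theorem smulSupp_mul (σ τ : Equiv.Perm (Fin n)) (m : p.support) :
    smulSupp (σ * τ) m = smulSupp σ (smulSupp τ m) :=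
  Subtype.ext (smulMon_mul σ τ m.1)

/-- The coefficient is constant along the action on the support. [folklore] -/
theorem coeffOf_smulSupp (σ : Equiv.Perm (Fin n)) (m : p.support) :
    coeffOf p (smulSupp σ m) = coeffOf p m :=
  Subtype.ext (coeff_smulMon hp.out σ m.1)

/-- `Sym(Fin n)` acts on the gates by relabelling positions and monomials. [folklore] -/
instance instMulAction : MulAction (Equiv.Perm (Fin n)) (Gate p D) where
  smul σ
    | inp pq => inp (σ • pq)
    | cpy m pq t => cpy (smulSupp σ m) (σ • pq) t
    | mono m => mono (smulSupp σ m)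
    | cst c => cst c
    | out => out
  one_smul g := by
    cases g with
    | inp pq => exact congrArg inp (one_smul _ pq)
    | cpy m pq t =>
      change cpy (smulSupp 1 m) ((1 : Equiv.Perm (Fin n)) • pq) t = cpy m pq t
      rw [smulSupp_one, one_smul]
    | mono m =>
      change mono (smulSupp 1 m) = mono m
      rw [smulSupp_one]
    | cst c => rfl
    | out => rfl
  mul_smul σ τ g := by
    cases g with
    | inp pq => exact congrArg inp (mul_smul σ τ pq)
    | cpy m pq t =>
      change cpy (smulSupp (σ * τ) m) ((σ * τ) • pq) t = cpy (smulSupp σ (smulSupp τ m)) (σ • τ • pq) t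
      rw [smulSupp_mul, mul_smul]
    | mono m =>
      change mono (smulSupp (σ * τ) m) = mono (smulSupp σ (smulSupp τ m))
      rw [smulSupp_mul]
    | cst c => rfl
    | out => rfl

/-- Action on input gates. [folklore] -/
@[simp] theorem smul_inp (σ : Equiv.Perm (Fin n)) (pq : Fin n × Fin n) :
    σ • (inp pq : Gate p D) = inp (σ • pq) := rfl
/-- Action on copy gates. [folklore] -/
@[simp] theorem smul_cpy (σ : Equiv.Perm (Fin n)) (m : p.support) (pq : Fin n × Fin n) (t : Fin D) :
    σ • (cpy m pq t : Gate p D) = cpy (smulSupp σ m) (σ • pq) t := rfl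
/-- Action on monomial gates. [folklore] -/
@[simp] theorem smul_mono (σ : Equiv.Perm (Fin n)) (m : p.support) :
    σ • (mono m : Gate p D) = mono (smulSupp σ m) := rfl
/-- Constant gates are fixed. [folklore] -/
@[simp] theorem smul_cst (σ : Equiv.Perm (Fin n)) (c : coeffs p) : σ • (cst c : Gate p D) = cst c := rfl
/-- The output gate is fixed. [folklore] -/
@[simp] theorem smul_out (σ : Equiv.Perm (Fin n)) : σ • (out : Gate p D) = out := rfl

end Gate

open Gate

/-- The copy gates wired into the monomial gate `m`: `cpy m pq t` for `pq ∈ supp m`, `t < m pq`.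
[folklore] -/
def copies (m : p.support) : Finset (Gate p D) :=
  ((m.1.support ×ˢ (Finset.univ : Finset (Fin D))).filter fun x => x.2.val < m.1 x.1).image
    fun x => cpy m x.1 x.2

/-- Children in the orbit circuit. [folklore] -/
def children : Gate p D → Finset (Gate p D)
  | inp _ => ∅
  | cpy _ pq _ => {inp pq}
  | mono m => insert (cst (coeffOf p m)) (copies m)
  | cst _ => ∅
  | out => Finset.univ.image fun m : p.support => mono m

/-- Labels in the orbit circuit. [folklore] -/
def label : Gate p D → CircuitLabel K (Fin n × Fin n)
  | inp pq => .var pq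
  | cpy _ _ _ => .add
  | mono _ => .mul
  | cst c => .const c.1
  | out => .add

/-- Rank of a gate, for acyclicity. [folklore] -/
def rank : Gate p D → ℕ
  | inp _ => 0
  | cpy _ _ _ => 1
  | mono _ => 2
  | cst _ => 0
  | out => 3

/-- Members of `copies m` are copy gates of `m`. [folklore] -/
theorem mem_copies {m : p.support} {g : Gate p D} (hg : g ∈ copies m) :
    ∃ pq t, g = cpy m pq t := by
  simp only [copies, Finset.mem_image] at hg
  obtain ⟨x, -, rfl⟩ := hg
  exact ⟨x.1, x.2, rfl⟩

/-- Children have smaller rank. [folklore] -/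
theorem rank_lt_of_mem_children {g h : Gate p D} (hh : h ∈ children g) : rank h < rank g := by
  cases g with
  | inp pq => simp [children] at hh
  | cpy m pq t =>
    simp only [children, Finset.mem_singleton] at hh
    subst hh; simp [rank]
  | mono m =>
    simp only [children, Finset.mem_insert] at hh
    rcases hh with rfl | hh
    · simp [rank]
    · obtain ⟨pq, t, rfl⟩ := mem_copies hh
      simp [rank]
  | cst c => simp [children] at hh
  | out =>
    simp only [children, Finset.mem_image, Finset.mem_univ, true_and] at hh
    obtain ⟨m, rfl⟩ := hh
    simp [rank]

variable [hp : Fact (∀ σ : Equiv.Perm (Fin n), rename (fun pq : Fin n × Fin n => σ • pq) p = p)]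

/-- The action maps the copies of `m` onto the copies of `σ • m`. [folklore] -/
theorem copies_smul (σ : Equiv.Perm (Fin n)) (m : p.support) :
    copies (D := D) (smulSupp σ m) =
      (copies m).map (MulAction.toPerm σ : Equiv.Perm (Gate p D)).toEmbedding := by
  ext g
  simp only [copies, Finset.mem_image, Finset.mem_filter, Finset.mem_product, Finset.mem_univ,
    and_true, Finset.mem_map, Equiv.toEmbedding_apply, MulAction.toPerm_apply, smulSupp_val,
    support_smulMon]
  constructor
  · rintro ⟨⟨pq', t⟩, ⟨hpq', ht⟩, rfl⟩
    obtain ⟨pq, hpq, rfl⟩ := hpq'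
    refine ⟨cpy m pq t, ⟨(pq, t), ⟨hpq, ?_⟩, rfl⟩, by simp⟩
    simpa using ht
  · rintro ⟨_, ⟨⟨pq, t⟩, ⟨hpq, ht⟩, rfl⟩, rfl⟩
    refine ⟨(σ • pq, t), ⟨⟨pq, hpq, rfl⟩, ?_⟩, rfl⟩
    simpa using ht

variable (p D)

/-- **The orbit circuit** of a diagonally invariant polynomial `p` (with `D` copies per input and
monomial), a `Sym(Fin n)`-symmetric arithmetic circuit; requires `p ≠ 0` (the output `+` gate
must have a child). [folklore] -/
def orbitCircuit (hp0 : p ≠ 0) :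
    SymmetricArithmeticCircuit (Equiv.Perm (Fin n)) K (Fin n × Fin n) Unit (Gate p D) where
  children := children
  label := label
  output _ := out
  wf := Subrelation.wf (fun {h g} (hh : h ∈ children g) => rank_lt_of_mem_children hh)
    (InvImage.wf rank Nat.lt_wfRel.wf)
  isInput_iff g := by
    cases g with
    | inp pq => simp [label, children]
    | cpy m pq t => simp [label, children]
    | mono m => simp [label, children]
    | cst c => simp [label, children]
    | out =>
      simp only [label, CircuitLabel.not_isInput_add, children, Finset.image_eq_empty,
        Finset.univ_eq_empty_iff, false_iff, not_isEmpty_iff]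
      obtain ⟨m, hm⟩ := support_nonempty.2 hp0
      exact ⟨⟨m, hm⟩⟩
  eq_of_label_eq g g' hg hl := by
    cases g with
    | inp pq =>
      cases g' <;> simp_all [label]
    | cpy m pq t => simp [label] at hg
    | mono m => simp [label] at hg
    | cst c =>
      cases g' <;> simp_all [label]
    | out => simp [label] at hg
  output_injective := fun _ _ _ => Subsingleton.elim _ _
  children_smul σ g := by
    cases g with
    | inp pq => simp [children]
    | cpy m pq t => simp [children, Finset.map_singleton]
    | mono m =>
      simp only [smul_mono, children, Finset.map_insert, Equiv.toEmbedding_apply,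
        MulAction.toPerm_apply, smul_cst, coeffOf_smulSupp, copies_smul]
    | cst c => simp [children]
    | out =>
      ext h
      simp only [smul_out, children, Finset.mem_image, Finset.mem_univ, true_and, Finset.mem_map,
        Equiv.toEmbedding_apply, MulAction.toPerm_apply]
      constructor
      · rintro ⟨m, rfl⟩
        exact ⟨mono (smulSupp σ⁻¹ m), ⟨smulSupp σ⁻¹ m, rfl⟩, by
          rw [smul_mono, ← smulSupp_mul, mul_inv_cancel, smulSupp_one]⟩
      · rintro ⟨_, ⟨m, rfl⟩, rfl⟩
        exact ⟨smulSupp σ m, rfl⟩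
  label_smul σ g := by cases g <;> rfl
  output_smul σ _ := rfl

end Circuit

end OrbitCircuit

end Literature.Computability.AlgebraicComplexity

end
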